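import Summits.Ventures.CertifiedManyBodySolver.Observables.PairLROOnePointCeilingAux
import Summits.Ventures.CertifiedManyBodySolver.Observables.SourcedOrderParameterCeilingInputs
import HarnessLib

/-!
# Pinning-field response menu nodes (II): HELLMANN–FEYNMAN BRACKETS — certified sourced energies at
# `h₁ < h < h₂` bracket the pair amplitude of EVERY (near-)ground state at source `h` (generic part)

HONEST FRAMING: zero compute; every statement is a PROVED implication whose numerical inputs are
hypotheses of the stated shape (no certificate is constructed or claimed); positivity/kinematic scale until
fed; a bracket on the sourced pair amplitude at `h > 0` is NOT a statement about `d`-wave order of the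
source-free Hubbard model (that needs a finite-`h` Kennedy–Lieb–Shastry / Koma–Tasaki inequality — cell
`hubbard-cq`, lens seats); not a superconductivity verdict; no phase sentence.

Cell `hubbard-obs` (D-0042 / D-0082 (c-2)), seat `hubbard-obs-pin-2` (`prover-hubbard-obs-pin-2-g0-0`), row
«pinning-field response menu nodes — Hellmann–Feynman brackets from certified `e₀(h ± δh)`» (sibling
`hubbard-obs-pin-1`: `h`-chords of the energy; `hubbard-cq-obsth-*`: transport nodes). Companion of
`Observables/SourcedOrderParameterCeiling.lean` / `…Inputs.lean` (obs-p1: the TRACIAL sourced density and the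
Koma–Tasaki order parameter are capped by `(u₀ − ℓ_H)/(2(H − h))`); sequel
`Observables/PinningFieldResponseBracketDWave.lean` (the `d`-wave sourced grand-canonical torus: ground-state
vectors, the tracial stair, today's inputs, what the floor side needs).

## The bracket

Let `A_L(h) = K_L − h·O_L` with `K_L` Hermitian ("unperturbed" torus Hamiltonian — `H_L(1,U) − μN_L` for the
tree's `dWaveSourceTorus L U μ h`, or a `t–t'` grand-canonical Hamiltonian) and `O_L = Δ_g + Δ_gᴴ`,
`Δ_g = pairField g L = Σ_x P_x` (Koma–Tasaki 1994 §1, the symmetry-breaking pair source). For EVERY unit vector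
`ψ` and reals `h₁ < h < h₂`, `ψ` is a trial state for `A_L(h₂)` and for `A_L(h₁)`:
`E₀(A_L(hᵢ)) ≤ ⟨ψ, A_L(hᵢ)ψ⟩ = ⟨ψ, A_L(h)ψ⟩ − (hᵢ − h)·⟨ψ, O_L ψ⟩`. Hence a CAP `⟨ψ, A_L(h)ψ⟩ ≤ u·L²`
(the state lies in the sourced energy window at `h`) and certified CUTS `ℓ₂·L² ≤ E₀(A_L(h₂))`,
`ℓ₁·L² ≤ E₀(A_L(h₁))` give the two-sided, program-free **Hellmann–Feynman bracket**

  `(ℓ₁ − u)/(h − h₁) ≤ L⁻²·Re⟨ψ, (Δ_g + Δ_gᴴ)ψ⟩ ≤ (u − ℓ₂)/(h₂ − h)`                 (§1–§2);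

per site `L⁻²·Re⟨ψ,(Δ_g + Δ_gᴴ)ψ⟩ = 2·Re (translation average of P₀ in ψ)`
(`torusAvgExpectAt_localPairAt_eq_expect_pairField_div`), so the bracket passes to EVERY torus-limit state `ω`
of such vectors: `(ℓ₁ − u)/(2(h − h₁)) ≤ Re ω(P₀) ≤ (u − ℓ₂)/(2(h₂ − h))` (§3). The inputs have the SHAPE of
record: cuts `∃ L₀, ∀ L ≥ L₀, ℓ·L² ≤ E₀(K_L − h'O_L)` — for `dWaveSourceTorus` literally the conclusion of the
gauge-broken window-certificate soundness theorems
`dWaveSourceTorus_groundEnergy_ge_of_window_certificate[_d4]_eventually` (pilots `hubbard-cq-pilot-1/2`);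
caps `∃ j₀, ∀ j ≥ j₀, Re⟨ψ_{Ls j}, A_{Ls j}(h) ψ_{Ls j}⟩ ≤ u·(Ls j)²` (ground-state vectors: any eventual upper
bound on `E₀(A_L(h))/L²`, sequel file).

## Contents

* §1 finite-dimensional core (`K`, `O` Hermitian, any unit `ψ`): `re_rayleigh_source_sub`,
  `re_rayleigh_le_of_cap_of_cut` (upper), `le_re_rayleigh_of_cut_of_cap` (lower),
  `re_rayleigh_eq_groundEnergy_of_eigen` (ground-state vectors realise the cap `E₀`).
* §2 finite torus, per site, general `K_L` and form factor `g`: `re_torusAvgExpectAt_localPairAt_eq`,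
  `re_torusAvgExpectAt_localPairAt_le_of_cap_of_cut`, `le_re_torusAvgExpectAt_localPairAt_of_cut_of_cap`.
* §3 thermodynamic limit, every torus-limit state in the sourced window (general `K_L`, `g`):
  `re_expect_localPairAt_le_of_sourced_cap_of_cut`, `le_re_expect_localPairAt_of_sourced_cut_of_cap`,
  `re_expect_localPairAt_mem_Icc_of_sourced_cuts_of_cap`.

References: T. Koma, H. Tasaki, J. Stat. Phys. 76 (1994) 745, §1 [KomaTasaki1994]; R. B. Griffiths,
Phys. Rev. 152 (1966) 240, §II (one-sided derivatives of the concave energy bound the conjugate observable)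
[Griffiths1966]; H. Tasaki, *Physics and Mathematics of Quantum Many-Body Systems* (2020) §2.1 (variational
principle) [Tasaki2020]; O. Bratteli, D. W. Robinson, *OAQSM 2* (1997) §6.2.4 (periodic boxes, space averages)
[BratteliRobinsonII1997].
Tree search: `lean search 'Hellmann|source_mem_Icc|of_cap_of_cut'` — `GroundStateSourceBounds`
(`re_groundStateFunctional_source_mem_Icc`, TRACIAL state, cap at `h = 0` only), `HubbardTTPrimeCapCutDualRows`
§8 (`docc_mem_Icc_chord_of_cap_of_cuts`, the `U`-direction twin for the on-site word), `SourcedOrderParameterCeiling`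
(ceiling only); no every-state / torus-limit sourced pair bracket.
-/

noncomputable section

namespace Summit.Ventures.CertifiedManyBodySolver.Observables

open Matrix Literature.MathematicalPhysics.QuantumLattice Literature.Probability.LatticeModels
open Literature.MathematicalPhysics.QuantumLattice.HubbardWave0 ThermodynamicLimit Filter Topology
open scoped ComplexOrder BigOperators

/-! ### §1 Finite-dimensional core: the Hellmann–Feynman bracket for one unit vector -/

section Core

variable {n : Type*} [Fintype n] [DecidableEq n]

omit [DecidableEq n] in
/-- The Rayleigh quotient of `K − h'O` versus `K − hO`: `⟨ψ,(K − h'O)ψ⟩ = ⟨ψ,(K − hO)ψ⟩ − (h' − h)⟨ψ,Oψ⟩`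
(real parts). [folklore] -/
theorem re_rayleigh_source_sub (K O : Matrix n n ℂ) (h h' : ℝ) (ψ : n → ℂ) :
    (star ψ ⬝ᵥ ((K - (h' : ℂ) • O) *ᵥ ψ)).re =
      (star ψ ⬝ᵥ ((K - (h : ℂ) • O) *ᵥ ψ)).re - (h' - h) * (star ψ ⬝ᵥ (O *ᵥ ψ)).re := by
  have hdecomp : K - (h' : ℂ) • O = (K - (h : ℂ) • O) - ((h' - h : ℝ) : ℂ) • O := by
    rw [Complex.ofReal_sub, sub_smul]
    abel
  rw [hdecomp, sub_mulVec, Matrix.smul_mulVec, dotProduct_sub, dotProduct_smul, Complex.sub_re, smul_eq_mul,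
    Complex.re_ofReal_mul]

/-- **Hellmann–Feynman bracket, UPPER half.** For Hermitian `K`, `O`, sources `h < h₂`, a unit vector `ψ`
with CAP `Re⟨ψ,(K − hO)ψ⟩ ≤ c` and a CUT `ℓ ≤ E₀(K − h₂O)`: `Re⟨ψ, O ψ⟩ ≤ (c − ℓ)/(h₂ − h)`
(`ψ` is a trial state for `K − h₂O`). [cite: KomaTasaki1994, §1] [cite: Griffiths1966, §II] -/
theorem re_rayleigh_le_of_cap_of_cut {K O : Matrix n n ℂ} (hK : K.IsHermitian) (hO : O.IsHermitian)
    {h h₂ : ℝ} (hlt : h < h₂) {ψ : n → ℂ} (hψ : star ψ ⬝ᵥ ψ = 1) {c ℓ : ℝ}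
    (hcap : (star ψ ⬝ᵥ ((K - (h : ℂ) • O) *ᵥ ψ)).re ≤ c)
    (hcut : ℓ ≤ (K - (h₂ : ℂ) • O).groundEnergy) :
    (star ψ ⬝ᵥ (O *ᵥ ψ)).re ≤ (c - ℓ) / (h₂ - h) := by
  have hray := Matrix.groundEnergy_le_rayleigh_holds (isHermitian_sub_real_smul hK hO h₂) ψ hψ
  rw [re_rayleigh_source_sub K O h h₂ ψ] at hray
  rw [le_div_iff₀ (sub_pos.2 hlt)]
  nlinarith [hray, hcap, hcut]

/-- **Hellmann–Feynman bracket, LOWER half.** For Hermitian `K`, `O`, sources `h₁ < h`, a unit vector `ψ`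
with CAP `Re⟨ψ,(K − hO)ψ⟩ ≤ c` and a CUT `ℓ ≤ E₀(K − h₁O)`: `(ℓ − c)/(h − h₁) ≤ Re⟨ψ, O ψ⟩`
(`ψ` is a trial state for `K − h₁O`). [cite: KomaTasaki1994, §1] [cite: Griffiths1966, §II] -/
theorem le_re_rayleigh_of_cut_of_cap {K O : Matrix n n ℂ} (hK : K.IsHermitian) (hO : O.IsHermitian)
    {h₁ h : ℝ} (hlt : h₁ < h) {ψ : n → ℂ} (hψ : star ψ ⬝ᵥ ψ = 1) {c ℓ : ℝ}
    (hcap : (star ψ ⬝ᵥ ((K - (h : ℂ) • O) *ᵥ ψ)).re ≤ c)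
    (hcut : ℓ ≤ (K - (h₁ : ℂ) • O).groundEnergy) :
    (ℓ - c) / (h - h₁) ≤ (star ψ ⬝ᵥ (O *ᵥ ψ)).re := by
  have hray := Matrix.groundEnergy_le_rayleigh_holds (isHermitian_sub_real_smul hK hO h₁) ψ hψ
  rw [re_rayleigh_source_sub K O h h₁ ψ] at hray
  rw [div_le_iff₀ (sub_pos.2 hlt)]
  nlinarith [hray, hcap, hcut]

/-- For a ground-state VECTOR the cap is the ground energy: if `Aψ = E₀(A)ψ` and `⟨ψ,ψ⟩ = 1` then
`Re⟨ψ, Aψ⟩ = E₀(A)`. [cite: Tasaki2020, §2.1] -/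
theorem re_rayleigh_eq_groundEnergy_of_eigen {A : Matrix n n ℂ} {ψ : n → ℂ} (hψ : star ψ ⬝ᵥ ψ = 1)
    (hA : A *ᵥ ψ = ((A.groundEnergy : ℝ) : ℂ) • ψ) :
    (star ψ ⬝ᵥ (A *ᵥ ψ)).re = A.groundEnergy := by
  rw [hA, dotProduct_smul, hψ, smul_eq_mul, mul_one, Complex.ofReal_re]

end Core

/-! ### §2 Finite torus, per site: the bracket on the translation-averaged local pair -/

section Torus

variable {L : ℕ} [NeZero L] (g : Site 2 → ℝ)

/-- `Re⟨ψ, Xᴴ ψ⟩ = Re⟨ψ, X ψ⟩`. [folklore] -/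
private theorem re_expect_conjTranspose_eq {ι : Type*} [LinearOrder ι] [Fintype ι]
    (X : Matrix (Finset ι) (Finset ι) ℂ) (ψ : Fock ι) : (expect Xᴴ ψ).re = (expect X ψ).re := by
  have h : expect Xᴴ ψ = star (expect X ψ) := by
    unfold expect
    rw [star_dotProduct ψ (Xᴴ *ᵥ ψ), star_mulVec, conjTranspose_conjTranspose, ← dotProduct_mulVec]
  rw [h, Complex.star_def, Complex.conj_re]

/-- `Re⟨ψ, (Δ_g + Δ_gᴴ) ψ⟩ = 2·Re⟨ψ, Δ_g ψ⟩`. [cite: KomaTasaki1994, §1] -/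
theorem re_expect_pairField_add_conjTranspose (ψ : Fock (Orb (FermionTorus 2 L))) :
    (expect (pairField g L + (pairField g L)ᴴ) ψ).re = 2 * (expect (pairField g L) ψ).re := by
  rw [expect_add, Complex.add_re, re_expect_conjTranspose_eq]
  ring

/-- **Per-site identity**: the real part of the translation-averaged expectation of the local pair `P₀` in a
torus vector is `Re⟨ψ,(Δ_g + Δ_gᴴ)ψ⟩/(2L²)`. [cite: BratteliRobinsonII1997, §6.2.4] -/
theorem re_torusAvgExpectAt_localPairAt_eq
    (hInj : Set.InjOn (Torus.proj (d := 2) L) ↑(pairRegion (insert (0 : Site 2) unitSteps) 0))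
    (ψ : Fock (Orb (FermionTorus 2 L))) :
    (torusAvgExpectAt L (pairRegion (insert (0 : Site 2) unitSteps) 0)
        (localPairAt (insert (0 : Site 2) unitSteps) g 0) ψ).re =
      (expect (pairField g L + (pairField g L)ᴴ) ψ).re / (2 * (L : ℝ) ^ 2) := by
  rw [torusAvgExpectAt_localPairAt_eq_expect_pairField_div g hInj ψ, re_expect_pairField_add_conjTranspose,
    show ((L : ℂ) ^ 2) = (((L : ℝ) ^ 2 : ℝ) : ℂ) by push_cast; rfl, Complex.div_ofReal_re]
  have hL : (0 : ℝ) < (L : ℝ) ^ 2 := cast_sq_pos_of_neZero L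
  field_simp

/-- **Finite-torus UPPER bracket per site** (general Hermitian `K_L`, form factor `g`): for `h < h₂`, a unit
torus vector `ψ` with cap `Re⟨ψ,(K_L − hO_L)ψ⟩ ≤ u·L²` and a cut `ℓ·L² ≤ E₀(K_L − h₂O_L)`, `O_L = Δ_g + Δ_gᴴ`:
`Re (translation average of P₀ in ψ) ≤ (u − ℓ)/(2(h₂ − h))`. [cite: KomaTasaki1994, §1] -/
theorem re_torusAvgExpectAt_localPairAt_le_of_cap_of_cut
    {K : Matrix (Finset (Orb (FermionTorus 2 L))) (Finset (Orb (FermionTorus 2 L))) ℂ} (hK : K.IsHermitian)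
    (hInj : Set.InjOn (Torus.proj (d := 2) L) ↑(pairRegion (insert (0 : Site 2) unitSteps) 0))
    {h h₂ : ℝ} (hlt : h < h₂) {ψ : Fock (Orb (FermionTorus 2 L))} (hψ : star ψ ⬝ᵥ ψ = 1) {u ℓ : ℝ}
    (hcap : (expect (K - (h : ℂ) • (pairField g L + (pairField g L)ᴴ)) ψ).re ≤ u * (L : ℝ) ^ 2)
    (hcut : ℓ * (L : ℝ) ^ 2 ≤ (K - (h₂ : ℂ) • (pairField g L + (pairField g L)ᴴ)).groundEnergy) :
    (torusAvgExpectAt L (pairRegion (insert (0 : Site 2) unitSteps) 0)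
        (localPairAt (insert (0 : Site 2) unitSteps) g 0) ψ).re ≤ (u - ℓ) / (2 * (h₂ - h)) := by
  have hO : (pairField g L + (pairField g L)ᴴ).IsHermitian := isHermitian_add_transpose_self _
  have hcore := re_rayleigh_le_of_cap_of_cut hK hO hlt hψ hcap hcut
  have hL : (0 : ℝ) < (L : ℝ) ^ 2 := cast_sq_pos_of_neZero L
  have hδ : 0 < h₂ - h := sub_pos.2 hlt
  rw [re_torusAvgExpectAt_localPairAt_eq g hInj ψ, div_le_div_iff₀ (by positivity) (by positivity)]
  have : (expect (pairField g L + (pairField g L)ᴴ) ψ).re * (h₂ - h) ≤ u * (L : ℝ) ^ 2 - ℓ * (L : ℝ) ^ 2 :=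
    (le_div_iff₀ hδ).1 hcore
  nlinarith [this]

/-- **Finite-torus LOWER bracket per site**: for `h₁ < h`, a unit `ψ` with cap `Re⟨ψ,(K_L − hO_L)ψ⟩ ≤ u·L²`
and a cut `ℓ·L² ≤ E₀(K_L − h₁O_L)`: `(ℓ − u)/(2(h − h₁)) ≤ Re (translation average of P₀ in ψ)`.
[cite: KomaTasaki1994, §1] -/
theorem le_re_torusAvgExpectAt_localPairAt_of_cut_of_cap
    {K : Matrix (Finset (Orb (FermionTorus 2 L))) (Finset (Orb (FermionTorus 2 L))) ℂ} (hK : K.IsHermitian)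
    (hInj : Set.InjOn (Torus.proj (d := 2) L) ↑(pairRegion (insert (0 : Site 2) unitSteps) 0))
    {h₁ h : ℝ} (hlt : h₁ < h) {ψ : Fock (Orb (FermionTorus 2 L))} (hψ : star ψ ⬝ᵥ ψ = 1) {u ℓ : ℝ}
    (hcap : (expect (K - (h : ℂ) • (pairField g L + (pairField g L)ᴴ)) ψ).re ≤ u * (L : ℝ) ^ 2)
    (hcut : ℓ * (L : ℝ) ^ 2 ≤ (K - (h₁ : ℂ) • (pairField g L + (pairField g L)ᴴ)).groundEnergy) :
    (ℓ - u) / (2 * (h - h₁)) ≤ (torusAvgExpectAt L (pairRegion (insert (0 : Site 2) unitSteps) 0)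
        (localPairAt (insert (0 : Site 2) unitSteps) g 0) ψ).re := by
  have hO : (pairField g L + (pairField g L)ᴴ).IsHermitian := isHermitian_add_transpose_self _
  have hcore := le_re_rayleigh_of_cut_of_cap hK hO hlt hψ hcap hcut
  have hL : (0 : ℝ) < (L : ℝ) ^ 2 := cast_sq_pos_of_neZero L
  have hδ : 0 < h - h₁ := sub_pos.2 hlt
  rw [re_torusAvgExpectAt_localPairAt_eq g hInj ψ, div_le_div_iff₀ (by positivity) (by positivity)]
  have : ℓ * (L : ℝ) ^ 2 - u * (L : ℝ) ^ 2 ≤ (expect (pairField g L + (pairField g L)ᴴ) ψ).re * (h - h₁) :=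
    (div_le_iff₀ hδ).1 hcore
  nlinarith [this]

end Torus

/-! ### §3 Thermodynamic limit: every torus-limit state in the sourced energy window -/

section TorusLimit

variable (g : Site 2 → ℝ)
  (K : (L : ℕ) → Matrix (Finset (Orb (FermionTorus 2 L))) (Finset (Orb (FermionTorus 2 L))) ℂ)

/-- **UPPER Hellmann–Feynman bracket in the thermodynamic limit (every state in the window).** Let
`A_L(h') = K_L − h'(Δ_g + Δ_gᴴ)` with `K_L` Hermitian, let `ω` be a torus limit of the translation averages of
unit vectors `ψ_{Ls j}`, `Ls → ∞`, lying eventually in the sourced energy window at `h`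
(`Re⟨ψ_L, A_L(h)ψ_L⟩ ≤ u·L²`), and let `ℓ·L² ≤ E₀(A_L(h₂))` for all large `L` at some `h₂ > h` (a certified
sourced LOWER bound). Then `Re ω(P₀) ≤ (u − ℓ)/(2(h₂ − h))`. [cite: KomaTasaki1994, §1] [cite: Griffiths1966, §II] -/
theorem re_expect_localPairAt_le_of_sourced_cap_of_cut (hK : ∀ (L : ℕ) [NeZero L], (K L).IsHermitian)
    {ω : InfVolFermionState 2} {ψ : ∀ L, Fock (Orb (FermionTorus 2 L))} {Ls : ℕ → ℕ}
    (hω : ω.IsTorusLimitOf ψ Ls) (hLs : Tendsto Ls atTop atTop) (h1 : ∀ j, star (ψ (Ls j)) ⬝ᵥ ψ (Ls j) = 1)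
    {h h₂ u ℓ : ℝ} (hlt : h < h₂)
    (hcap : ∃ j₀ : ℕ, ∀ (j : ℕ) [NeZero (Ls j)], j₀ ≤ j →
      (expect (K (Ls j) - (h : ℂ) • (pairField g (Ls j) + (pairField g (Ls j))ᴴ)) (ψ (Ls j))).re ≤
        u * ((Ls j : ℕ) : ℝ) ^ 2)
    (hcut : ∃ L₀ : ℕ, ∀ (L : ℕ) [NeZero L], L₀ ≤ L →
      ℓ * (L : ℝ) ^ 2 ≤ (K L - (h₂ : ℂ) • (pairField g L + (pairField g L)ᴴ)).groundEnergy) :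
    (ω.expect (pairRegion (insert (0 : Site 2) unitSteps) 0) (localPairAt (insert (0 : Site 2) unitSteps) g 0)).re ≤
      (u - ℓ) / (2 * (h₂ - h)) := by
  obtain ⟨j₀, hj₀⟩ := hcap
  obtain ⟨L₀, hL₀⟩ := hcut
  set Λ := pairRegion (insert (0 : Site 2) unitSteps) 0
  set P : FermionOp Λ := localPairAt (insert (0 : Site 2) unitSteps) g 0
  have hlim : Tendsto (fun j => (torusAvgExpect (Ls j) Λ P (ψ (Ls j))).re) atTop (𝓝 (ω.expect Λ P).re) :=
    (Complex.continuous_re.tendsto _).comp (hω Λ P)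
  refine le_of_tendsto hlim ?_
  filter_upwards [eventually_injOn_proj_of_tendsto Λ hLs, hLs.eventually_ge_atTop (max L₀ 1),
    eventually_ge_atTop j₀] with j hInj hjL hj
  haveI : NeZero (Ls j) := ⟨by omega⟩
  rw [torusAvgExpect_eq]
  exact re_torusAvgExpectAt_localPairAt_le_of_cap_of_cut g (hK (Ls j)) hInj hlt (h1 j) (hj₀ j hj)
    (hL₀ (Ls j) (le_trans (le_max_left _ _) hjL))

/-- **LOWER Hellmann–Feynman bracket in the thermodynamic limit (every state in the window)**: with a cut
`ℓ·L² ≤ E₀(A_L(h₁))` at some `h₁ < h` and the cap at `h` as above, `(ℓ − u)/(2(h − h₁)) ≤ Re ω(P₀)`.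
[cite: KomaTasaki1994, §1] [cite: Griffiths1966, §II] -/
theorem le_re_expect_localPairAt_of_sourced_cut_of_cap (hK : ∀ (L : ℕ) [NeZero L], (K L).IsHermitian)
    {ω : InfVolFermionState 2} {ψ : ∀ L, Fock (Orb (FermionTorus 2 L))} {Ls : ℕ → ℕ}
    (hω : ω.IsTorusLimitOf ψ Ls) (hLs : Tendsto Ls atTop atTop) (h1 : ∀ j, star (ψ (Ls j)) ⬝ᵥ ψ (Ls j) = 1)
    {h₁ h u ℓ : ℝ} (hlt : h₁ < h)
    (hcap : ∃ j₀ : ℕ, ∀ (j : ℕ) [NeZero (Ls j)], j₀ ≤ j →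
      (expect (K (Ls j) - (h : ℂ) • (pairField g (Ls j) + (pairField g (Ls j))ᴴ)) (ψ (Ls j))).re ≤
        u * ((Ls j : ℕ) : ℝ) ^ 2)
    (hcut : ∃ L₀ : ℕ, ∀ (L : ℕ) [NeZero L], L₀ ≤ L →
      ℓ * (L : ℝ) ^ 2 ≤ (K L - (h₁ : ℂ) • (pairField g L + (pairField g L)ᴴ)).groundEnergy) :
    (ℓ - u) / (2 * (h - h₁)) ≤
      (ω.expect (pairRegion (insert (0 : Site 2) unitSteps) 0) (localPairAt (insert (0 : Site 2) unitSteps) g 0)).re := by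
  obtain ⟨j₀, hj₀⟩ := hcap
  obtain ⟨L₀, hL₀⟩ := hcut
  set Λ := pairRegion (insert (0 : Site 2) unitSteps) 0
  set P : FermionOp Λ := localPairAt (insert (0 : Site 2) unitSteps) g 0
  have hlim : Tendsto (fun j => (torusAvgExpect (Ls j) Λ P (ψ (Ls j))).re) atTop (𝓝 (ω.expect Λ P).re) :=
    (Complex.continuous_re.tendsto _).comp (hω Λ P)
  refine ge_of_tendsto hlim ?_
  filter_upwards [eventually_injOn_proj_of_tendsto Λ hLs, hLs.eventually_ge_atTop (max L₀ 1),
    eventually_ge_atTop j₀] with j hInj hjL hj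
  haveI : NeZero (Ls j) := ⟨by omega⟩
  rw [torusAvgExpect_eq]
  exact le_re_torusAvgExpectAt_localPairAt_of_cut_of_cap g (hK (Ls j)) hInj hlt (h1 j) (hj₀ j hj)
    (hL₀ (Ls j) (le_trans (le_max_left _ _) hjL))

/-- **Two-sided Hellmann–Feynman bracket in the thermodynamic limit**: cuts at `h₁ < h < h₂` and the cap at
`h` give `Re ω(P₀) ∈ [(ℓ₁ − u)/(2(h − h₁)), (u − ℓ₂)/(2(h₂ − h))]` for every torus-limit state in the sourced
window at `h`. [cite: KomaTasaki1994, §1] [cite: Griffiths1966, §II] -/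
theorem re_expect_localPairAt_mem_Icc_of_sourced_cuts_of_cap (hK : ∀ (L : ℕ) [NeZero L], (K L).IsHermitian)
    {ω : InfVolFermionState 2} {ψ : ∀ L, Fock (Orb (FermionTorus 2 L))} {Ls : ℕ → ℕ}
    (hω : ω.IsTorusLimitOf ψ Ls) (hLs : Tendsto Ls atTop atTop) (h1 : ∀ j, star (ψ (Ls j)) ⬝ᵥ ψ (Ls j) = 1)
    {h₁ h h₂ u ℓ₁ ℓ₂ : ℝ} (hlo : h₁ < h) (hhi : h < h₂)
    (hcap : ∃ j₀ : ℕ, ∀ (j : ℕ) [NeZero (Ls j)], j₀ ≤ j →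
      (expect (K (Ls j) - (h : ℂ) • (pairField g (Ls j) + (pairField g (Ls j))ᴴ)) (ψ (Ls j))).re ≤
        u * ((Ls j : ℕ) : ℝ) ^ 2)
    (hcut₁ : ∃ L₀ : ℕ, ∀ (L : ℕ) [NeZero L], L₀ ≤ L →
      ℓ₁ * (L : ℝ) ^ 2 ≤ (K L - (h₁ : ℂ) • (pairField g L + (pairField g L)ᴴ)).groundEnergy)
    (hcut₂ : ∃ L₀ : ℕ, ∀ (L : ℕ) [NeZero L], L₀ ≤ L →
      ℓ₂ * (L : ℝ) ^ 2 ≤ (K L - (h₂ : ℂ) • (pairField g L + (pairField g L)ᴴ)).groundEnergy) :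
    (ω.expect (pairRegion (insert (0 : Site 2) unitSteps) 0) (localPairAt (insert (0 : Site 2) unitSteps) g 0)).re ∈
      Set.Icc ((ℓ₁ - u) / (2 * (h - h₁))) ((u - ℓ₂) / (2 * (h₂ - h))) :=
  ⟨le_re_expect_localPairAt_of_sourced_cut_of_cap g K hK hω hLs h1 hlo hcap hcut₁,
    re_expect_localPairAt_le_of_sourced_cap_of_cut g K hK hω hLs h1 hhi hcap hcut₂⟩

end TorusLimit

end Summit.Ventures.CertifiedManyBodySolver.Observables

end
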